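import Literature.NumberTheory.GaloisRepresentations.LubinTateColemanCoordBaseChangeTwo
import Literature.NumberTheory.GaloisRepresentations.LubinTateColemanUnitsImageSpecializationTwo
import Literature.NumberTheory.GaloisRepresentations.LubinTateColemanCoordMomentsSeparationUnramifiedTwo
import HarnessLib

/-!
# `φ_ε(Σ_j Col β (j)) ≠ 0` from ONE non-vanishing Galois trace of a Coates–Wiles moment of `β` — the (c)-capstone's analytic input
# `L_ε ≠ 0` (de Shalit III §1.4 Cor. 1.5 / II §4.12 (31)) reduced to a single level-`m` number

De Shalit, *Iwasawa theory of elliptic curves with complex multiplication* (1987), II §4.12 (31) ("the measure `μ(𝔣)` is determined by its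
moments … `(N𝔞 − ψ(𝔞)^k)·∫κ^k dμ = δ_k(e(𝔞))`"), III §1.4 Cor. 1.5 (the characteristic power series of `(𝒰/𝒞)_χ` is non-zero because SOME
Coates–Wiles value of an elliptic unit is non-zero).  The (c)-capstones of the tree (`Summit…ColemanCoinvariantCharTrace*`) carry this as the
hypothesis `hL0 : L_ε ≠ 0`, equivalently (`ne_zero_iff_colemanDeltaCoinvFun_ne_zero_of_twistMul`) **`φ_ε(Σ_j Col β_{a₁} (j)) ≠ 0`** for the
two-variable `ε`-projection `φ_ε : M₁ → 𝒪_F⟦X⟧⟦T⟧` of the `ℤ/d`-trace of the Coleman transform of ONE coherent family.  THIS file reduces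
that to ONE level-`m` number (everything PROVED, 0 sorry, no definitions, no named facts):

* `constantCoeff_comp_intBase` — the specialisation `κ_m = ι_m ∘ (X ↦ 0) : 𝒪_F⟦X⟧ → 𝒪_{E_m}` is a map of `𝒪_F`-algebras
  (`κ_m ∘ intBase = algebraMap`), so `LubinTateColemanCoordBaseChangeTwo` applies: `φ^{E_m}_{κ_m ε}(κ_m x) = κ_m(φ_ε x)`;
* ★★★ **`colemanDeltaCoinvFun_indexTraceₗ_colemanImage_ne_zero_of_sum_coordMoment_ne_zero`** — if `κ_m ε = (−1)^{k+1}` (the parity of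
  the weight `k` matches `ε`) and **`Σ_{σ ∈ Gal(E_m/F)} σ(mom_k(r_{β,m})) ≠ 0`** (the Galois trace of the `k`-th Coates–Wiles moment of the
  level-`m` coordinate of `β`; `mom_k(r_β)` is the Coates–Wiles value by `coordMoment_relUnitCoordTwo_eq_coatesWiles`), then
  **`φ_ε(Σ_j Col β (j)) ≠ 0`**.  Chain: `(Σ_σ σθ_m)·mom_k(κ_m Σ_j Col β (j)) = Σ_σ σ(mom_k r_{β,m})`
  (`LubinTateColemanUnitsImageSpecializationTwo`), `mom_k = tEval_{a_k} ∘ φ_{(−1)^{k+1}} · mom_k(1)`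
  (`coordMoment_eq_tEval_colemanDeltaCoinvFun`), and base change.

So the consumer of the capstone owes, for (L), exactly: a level `m` and a weight `k ≡ parity(ε)` with ONE non-zero Galois trace of a
Coates–Wiles value of `e(𝔞₁)` — by II §4.9–4.10 an explicit non-zero multiple of `L_{𝔣}(ψ̄^{k}, k)`, non-zero for `k` large.

Cell `bsd-print-cf2`, width seat `bsd-line-cf2c-w7` g18 (debt (L) of g14–g17, Coleman side).

## References
* E. de Shalit, *Iwasawa theory of elliptic curves with complex multiplication* (1987), Ch. I §3.5 (11), §3.8 (16)–(17); Ch. II §4.12 (31);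
  Ch. III §1.4 (5), Cor. 1.5, §1.10 (17). [deShalit1987]
-/

noncomputable section

namespace Literature.NumberTheory.EllipticCurves

open ValuativeRel IsLocalRing Field Finset
open Literature.NumberTheory.GaloisRepresentations Literature.NumberTheory.GaloisRepresentations.IsNonarchimedeanLocalField
  Literature.NumberTheory.GaloisRepresentations.LubinTate

variable {F : Type} [Field F] [ValuativeRel F] [TopologicalSpace F] [IsNonarchimedeanLocalField F]

attribute [local instance] ltNormUniformSpace ltNormIsUniformAddGroup rk1 nF nE fintypeResidueField

/-! ### The specialisation `κ_m = ι_m ∘ (X ↦ 0)` is a map of `𝒪_F`-algebras -/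

/-- **`(ι_{E} ∘ [X⁰]) ∘ intBase = algebraMap : 𝒪_F → 𝒪_E`** — the specialisation `X ↦ 0` followed by the inclusion of coefficients is a map
of `𝒪_F`-algebras from `𝒪_F⟦X⟧` to `𝒪_E`. [cite: deShalit1987, Ch. I §3.8 (17)] -/
theorem constantCoeff_comp_intBase (E₁ : IntermediateField F (AlgebraicClosure F)) [FiniteDimensional F E₁] :
    ((algebraMap 𝒪[F] (unitBall E₁)).comp (PowerSeries.constantCoeff (R := 𝒪[F]))).comp (intBase F) =
      algebraMap (LTCoeff F) (unitBall E₁) := by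
  refine RingHom.ext fun a => ?_
  rw [RingHom.comp_apply, RingHom.comp_apply]
  change algebraMap 𝒪[F] (unitBall E₁) (PowerSeries.constantCoeff (PowerSeries.C ((LTCoeff.of F).symm a))) =
    algebraMap (LTCoeff F) (unitBall E₁) ((LTCoeff.of F) ((LTCoeff.of F).symm a))
  rw [PowerSeries.constantCoeff_C, RingEquiv.apply_symm_apply]
  rfl

/-! ### The reduction of `φ_ε(Σ_j Col β (j)) ≠ 0` to one moment -/

section Moment

variable {p : ℕ} [hp : Fact p.Prime] {d : ℕ} [NeZero d] (hd : d.Coprime p)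
variable {π : 𝒪[F]} (hπ : (valuation F).IsUniformizer (π : F))
variable (E : ℕ → IntermediateField F (AlgebraicClosure F)) [∀ m, FiniteDimensional F (E m)] [∀ m, Normal F (E m)]
  [∀ m, IsGalois F (E m)] (hmono : Monotone E) (hE : ∀ m, E m ≤ maxUnramified F) (hdeg : ∀ m, Module.finrank F (E m) = d * p ^ m)
  {σ₀ : absoluteGaloisGroup F} (hσ₀ : IsAbsArithFrob σ₀) (hq : residueFieldCard F = 2)
variable (u : (LTCoeff F)ˣ) (hu : LTCoeff.of F π = residueFieldCard F * u) (γ : 𝒪[F]ˣ)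
variable [IsAdicComplete (Ideal.span {intBase F (LTCoeff.of F π)}) (PowerSeries 𝒪[F])]
variable (w : 𝒪[F]ˣ) (hγ : (γ : 𝒪[F]) = 1 + π ^ 2 * w) (ε : PowerSeries (PowerSeries 𝒪[F]))
variable [IsAdicComplete (Ideal.span {(p : 𝒪[F])}) 𝒪[F]]
variable {θ : ∀ m, unitBall (E m)} (hθ : ∀ m, IsIntegralNormalGen (E m) (θ m))
  (hcoh : ∀ m, unitBallTrace (hmono (Nat.le_succ m)) (θ (m + 1)) = θ m)

include hdeg hE hσ₀ in
/-- ★★★ **`φ_ε(Σ_j Col β (j)) ≠ 0` FROM ONE NON-ZERO GALOIS TRACE OF A COATES–WILES MOMENT**: if the weight `k` has the parity of `ε`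
(`κ_m ε = (−1)^{k+1}`, `κ_m = ι_m ∘ (X ↦ 0)`) and `Σ_{σ ∈ Gal(E_m/F)} σ(mom_k(r_{β,m})) ≠ 0`, then the two-variable `ε`-projection of the
`ℤ/d`-trace of `Col β` is non-zero.  This is the (c)-capstone's input `L_ε ≠ 0` for `β = β_{a₁}`
(`ne_zero_iff_colemanDeltaCoinvFun_ne_zero_of_twistMul`). [cite: deShalit1987, Ch. II §4.12 (31); Ch. III §1.4 Cor. 1.5, §1.10 (17)] -/
theorem colemanDeltaCoinvFun_indexTraceₗ_colemanImage_ne_zero_of_sum_coordMoment_ne_zero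
    {β : ∀ m, RelNormCoherentUnits hπ (E m)} (hβ : ∀ m, (β (m + 1)).baseNorm hπ (hmono (Nat.le_succ m)) = β m) (m k : ℕ)
    [IsAdicComplete (Ideal.span {algebraMap (LTCoeff F) (unitBall (E m)) (LTCoeff.of F π)}) (unitBall (E m))]
    (hεk : PowerSeries.map ((algebraMap 𝒪[F] (unitBall (E m))).comp (PowerSeries.constantCoeff (R := 𝒪[F]))) ε = (-1) ^ (k + 1))
    (hmom : ∑ σ : E m ≃ₐ[F] E m, unitBallEquiv (E m) σ (coordMoment hπ (E m) u k (relUnitCoordTwo hπ (E m) hq (hE m) hσ₀ u hu (β m))) ≠ 0) :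
    colemanDeltaCoinvFun hπ hq (intBase F) u hu γ (eq_zero_of_C_pi_mul_eq_zero_integer hπ) w hγ ε
        (indexTraceₗ hπ hq u hu γ (colemanImage hd hπ E hmono hE hdeg hσ₀ hq u hu γ hθ hcoh hβ)) ≠ 0 := by
  intro h0
  set κ : PowerSeries 𝒪[F] →+* unitBall (E m) := (algebraMap 𝒪[F] (unitBall (E m))).comp (PowerSeries.constantCoeff (R := 𝒪[F])) with hκ
  set x := indexTraceₗ hπ hq u hu γ (colemanImage hd hπ E hmono hE hdeg hσ₀ hq u hu γ hθ hcoh hβ) with hx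
  -- the specialised element `H = κ_m(Σ_j Col β (j))` and its `φ`
  have hreg' : ∀ y : unitBall (E m), algebraMap (LTCoeff F) (unitBall (E m)) (LTCoeff.of F π) * y = 0 → y = 0 :=
    fun y hy => eq_zero_of_algebraMap_ltCoeff_pi_mul_eq_zero hπ (E m) y hy
  have hbc := colemanDeltaCoinvFun_map hπ hq (intBase F) (algebraMap (LTCoeff F) (unitBall (E m))) κ (constantCoeff_comp_intBase (E m))
    u hu γ (eq_zero_of_C_pi_mul_eq_zero_integer hπ) hreg' w hγ ε x
  rw [h0, map_zero, hεk] at hbc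
  -- the `k`-th moment of `H` vanishes
  have hH : PowerSeries.map κ (TActModule.toPS x) =
      PowerSeries.map (algebraMap 𝒪[F] (unitBall (E m))) (PowerSeries.map (PowerSeries.constantCoeff (R := 𝒪[F]))
        (∑ j : ZMod d, TActModule.toPS (colemanImage hd hπ E hmono hE hdeg hσ₀ hq u hu γ hθ hcoh hβ j))) := by
    rw [hκ, PowerSeries.map_comp, RingHom.comp_apply, hx, indexTraceₗ_apply, map_sum]
  have hmomH : coordMoment hπ (E m) u k (PowerSeries.map κ (TActModule.toPS x)) = 0 := by
    have h := coordMoment_eq_tEval_colemanDeltaCoinvFun hπ (E m) hq u hu γ hreg' w hγ k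
      (TActModule.ofPS _ _ (PowerSeries.map κ (TActModule.toPS x)) :
        ColemanCoordModule hπ hq (algebraMap (LTCoeff F) (unitBall (E m))) u hu γ)
    rw [TActModule.toPS_ofPS, hbc, ← tEvalHom_apply, map_zero, zero_mul] at h
    exact h
  have hspec := sum_unitBallEquiv_mul_coordMoment_specialization hd hπ E hmono hE hdeg hσ₀ hq u hu γ hθ hcoh hβ m k
  rw [← hH, hmomH, mul_zero] at hspec
  exact hmom hspec.symm

end Moment

end Literature.NumberTheory.EllipticCurves
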